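/-
  HodgeLocusCensusInclusionRankDecomp.lean — pub-hlocus ENGINE B (ivhs-2, gen 55), PROBE 15d (successor material, R-L572 (b)/(d); probe-only, NOT filed).
  certified instances and evidence bearing on the general Hodge conjecture; no claim.

  KERNEL RANK THEOREMS (evidence class; linear algebra of inclusion matrices; nothing about HC). DECOMPOSITION OF THE SPACES S_j(V) (`mem_iSup_erase`):
  for #V ≥ 2j + 1, S_j(V) ⊆ Σ_{q ∈ V} S_j(V ∖ q), where S_j(V) := (⨅_{k<j} ker ψ_{k←j}) ⊓ (⨅_{B ⊄ V} ker eval_B) is written out at every use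
  (no definition; ψ_{k←j} := W_{k,j}.mulVecLin, W S T = [S ⊆ T]). Proof (induction on j): pick a ∈ V, write z = z₀ + ins_a del_a z with z₀ supported
  off a; del_a z ∈ S_{j−1}(V ∖ a) decomposes twice one level down (#(V ∖ a) ≥ 2j − 1 + 1 points) into pieces u ∈ S_{j−1}(V ∖ {a,q,q'}); each
  Δ_{a,q'} u lies in S_j(V ∖ q) (PROBE 15c `delta_mem`) and ins_a u − Δ_{a,q'} u = ins_{q'} u is supported off a; the remainder z − Σ lies in
  S_j(V ∖ a) by the shadow identities of PROBE 15b/15c. Used by PROBE 15e (`exists_lift`, Wilson's theorem).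
  1 theorems, 0 defs; imports PROBE 15c `…HodgeLocusCensusInclusionRankShadows` by name; no sorries, axioms, instances or notation.
-/
import Summits.HodgeConjecture.HodgeConjecture.Theorems.HodgeLocusCensusInclusionRankShadows

set_option linter.dupNamespace false
set_option autoImplicit false

namespace Summit.HodgeConjecture.HodgeConjecture.HodgeLocus.Census.InclusionRankDecomp

open Module
open Summit.HodgeConjecture.HodgeConjecture.HodgeLocus.Census.InclusionRankPointOps
open Summit.HodgeConjecture.HodgeConjecture.HodgeLocus.Census.InclusionRankShadows

variable (K : Type*) [Field K] {α : Type*} [Fintype α] [DecidableEq α]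
/-! ## §5 DECOMPOSITION: above `2j` points, `S_j(V) ⊆ Σ_{q ∈ V} S_j(V ∖ q)` -/

/-- DECOMPOSITION: for `2j + 1 ≤ #V`, every `z ∈ S_j(V)` lies in `⨆_{q ∈ V} S_j(V.erase q)`
(`S_j(V)` written out: the vectors on `j`-sets killed by every `W_{k,j}`, `k < j`, and supported on the `j`-subsets of `V`). -/
theorem mem_iSup_erase : ∀ (j : ℕ) (V : Finset α) (z : {S : Finset α // S.card = j} → K), 2 * j + 1 ≤ V.card →
    z ∈ ((⨅ (k : ℕ) (_ : k < j),
          LinearMap.ker (Matrix.mulVecLin (Matrix.of fun (S : {S : Finset α // S.card = k}) (T : {S : Finset α // S.card = j}) =>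
        if S.1 ⊆ T.1 then (1 : K) else 0))) ⊓
        (⨅ (B : {S : Finset α // S.card = j}) (_ : ¬ B.1 ⊆ V),
          LinearMap.ker (LinearMap.proj (R := K) (φ := fun _ : {S : Finset α // S.card = j} => K) B))) → z ∈ ⨆ q ∈ V, ((⨅ (k : ℕ) (_ : k < j),
          LinearMap.ker (Matrix.mulVecLin (Matrix.of fun (S : {S : Finset α // S.card = k}) (T : {S : Finset α // S.card = j}) =>
        if S.1 ⊆ T.1 then (1 : K) else 0))) ⊓
        (⨅ (B : {S : Finset α // S.card = j}) (_ : ¬ B.1 ⊆ (V.erase q)),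
          LinearMap.ker (LinearMap.proj (R := K) (φ := fun _ : {S : Finset α // S.card = j} => K) B))) := by
  intro j
  induction j with
  | zero =>
    intro V z hV hz
    obtain ⟨a, haV⟩ : V.Nonempty := Finset.card_pos.mp (by omega)
    refine Submodule.mem_iSup_of_mem a (Submodule.mem_iSup_of_mem haV ?_)
    rw [mem_shadowKer]
    refine ⟨fun k hk => absurd hk (Nat.not_lt_zero k), fun B hB => absurd ?_ hB⟩
    rw [Finset.card_eq_zero.mp B.2]
    exact Finset.empty_subset _
  | succ j ih =>
    intro V z hV hz
    obtain ⟨a, haV⟩ : V.Nonempty := Finset.card_pos.mp (by omega)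
    have hz' := (mem_shadowKer K (j + 1) V z).mp hz
    have hd1 : Matrix.mulVecLin (Matrix.of fun (B' : {S : Finset α // S.card = j}) (B : {S : Finset α // S.card = j + 1}) =>
        if B.1 = insert a B'.1 then (1 : K) else 0) z ∈ ((⨅ (k : ℕ) (_ : k < j),
          LinearMap.ker (Matrix.mulVecLin (Matrix.of fun (S : {S : Finset α // S.card = k}) (T : {S : Finset α // S.card = j}) =>
        if S.1 ⊆ T.1 then (1 : K) else 0))) ⊓
        (⨅ (B : {S : Finset α // S.card = j}) (_ : ¬ B.1 ⊆ (V.erase a)),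
          LinearMap.ker (LinearMap.proj (R := K) (φ := fun _ : {S : Finset α // S.card = j} => K) B))) := del_mem K a j V z hz
    have hcard₀ : (V.erase a).card + 1 = V.card := Finset.card_erase_add_one haV
    -- the motive `P w :≡ ∃ d ∈ ⨆_{q'} S_{j+1}(V ∖ q'), supp (ins_a w − d) ⊆ V ∖ a`, its closure properties
    have hP0 : ∃ d : {S : Finset α // S.card = j + 1} → K, d ∈ (⨆ q' ∈ V, ((⨅ (k : ℕ) (_ : k < (j + 1)),
          LinearMap.ker (Matrix.mulVecLin (Matrix.of fun (S : {S : Finset α // S.card = k}) (T : {S : Finset α // S.card = (j + 1)}) =>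
        if S.1 ⊆ T.1 then (1 : K) else 0))) ⊓
        (⨅ (B : {S : Finset α // S.card = (j + 1)}) (_ : ¬ B.1 ⊆ (V.erase q')),
          LinearMap.ker (LinearMap.proj (R := K) (φ := fun _ : {S : Finset α // S.card = (j + 1)} => K) B)))) ∧
        ∀ B : {S : Finset α // S.card = j + 1}, ¬ B.1 ⊆ V.erase a →
          (Matrix.mulVecLin (Matrix.of fun (B : {S : Finset α // S.card = j + 1}) (B' : {S : Finset α // S.card = j}) =>
        if B.1 = insert a B'.1 then (1 : K) else 0) (0 : {S : Finset α // S.card = j} → K) - d) B = 0 :=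
      ⟨0, Submodule.zero_mem _, fun B _ => by rw [map_zero, sub_zero, Pi.zero_apply]⟩
    have hPadd : ∀ x y : {S : Finset α // S.card = j} → K,
        (∃ d : {S : Finset α // S.card = j + 1} → K, d ∈ (⨆ q' ∈ V, ((⨅ (k : ℕ) (_ : k < (j + 1)),
          LinearMap.ker (Matrix.mulVecLin (Matrix.of fun (S : {S : Finset α // S.card = k}) (T : {S : Finset α // S.card = (j + 1)}) =>
        if S.1 ⊆ T.1 then (1 : K) else 0))) ⊓
        (⨅ (B : {S : Finset α // S.card = (j + 1)}) (_ : ¬ B.1 ⊆ (V.erase q')),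
          LinearMap.ker (LinearMap.proj (R := K) (φ := fun _ : {S : Finset α // S.card = (j + 1)} => K) B)))) ∧
          ∀ B : {S : Finset α // S.card = j + 1}, ¬ B.1 ⊆ V.erase a
              → (Matrix.mulVecLin (Matrix.of fun (B : {S : Finset α // S.card = j + 1}) (B' : {S : Finset α // S.card = j}) =>
        if B.1 = insert a B'.1 then (1 : K) else 0) x - d) B = 0) →
        (∃ d : {S : Finset α // S.card = j + 1} → K, d ∈ (⨆ q' ∈ V, ((⨅ (k : ℕ) (_ : k < (j + 1)),
          LinearMap.ker (Matrix.mulVecLin (Matrix.of fun (S : {S : Finset α // S.card = k}) (T : {S : Finset α // S.card = (j + 1)}) =>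
        if S.1 ⊆ T.1 then (1 : K) else 0))) ⊓
        (⨅ (B : {S : Finset α // S.card = (j + 1)}) (_ : ¬ B.1 ⊆ (V.erase q')),
          LinearMap.ker (LinearMap.proj (R := K) (φ := fun _ : {S : Finset α // S.card = (j + 1)} => K) B)))) ∧
          ∀ B : {S : Finset α // S.card = j + 1}, ¬ B.1 ⊆ V.erase a
              → (Matrix.mulVecLin (Matrix.of fun (B : {S : Finset α // S.card = j + 1}) (B' : {S : Finset α // S.card = j}) =>
        if B.1 = insert a B'.1 then (1 : K) else 0) y - d) B = 0) →
        (∃ d : {S : Finset α // S.card = j + 1} → K, d ∈ (⨆ q' ∈ V, ((⨅ (k : ℕ) (_ : k < (j + 1)),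
          LinearMap.ker (Matrix.mulVecLin (Matrix.of fun (S : {S : Finset α // S.card = k}) (T : {S : Finset α // S.card = (j + 1)}) =>
        if S.1 ⊆ T.1 then (1 : K) else 0))) ⊓
        (⨅ (B : {S : Finset α // S.card = (j + 1)}) (_ : ¬ B.1 ⊆ (V.erase q')),
          LinearMap.ker (LinearMap.proj (R := K) (φ := fun _ : {S : Finset α // S.card = (j + 1)} => K) B)))) ∧
          ∀ B : {S : Finset α // S.card = j + 1}, ¬ B.1 ⊆ V.erase a →
            (Matrix.mulVecLin (Matrix.of fun (B : {S : Finset α // S.card = j + 1}) (B' : {S : Finset α // S.card = j}) =>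
        if B.1 = insert a B'.1 then (1 : K) else 0) (x + y) - d) B = 0) := by
      rintro x y ⟨d, hd, hd'⟩ ⟨e, he, he'⟩
      refine ⟨d + e, Submodule.add_mem _ hd he, fun B hB => ?_⟩
      have e1 := hd' B hB
      have e2 := he' B hB
      rw [Pi.sub_apply] at e1 e2 ⊢
      rw [map_add, Pi.add_apply, Pi.add_apply]
      linear_combination e1 + e2
    have hPpiece : ∀ q : α, q ∈ V.erase a → ∀ q' : α, q' ∈ (V.erase a).erase q → ∀ u : {S : Finset α // S.card = j} → K,
        u ∈ ((⨅ (k : ℕ) (_ : k < j),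
          LinearMap.ker (Matrix.mulVecLin (Matrix.of fun (S : {S : Finset α // S.card = k}) (T : {S : Finset α // S.card = j}) =>
        if S.1 ⊆ T.1 then (1 : K) else 0))) ⊓
        (⨅ (B : {S : Finset α // S.card = j}) (_ : ¬ B.1 ⊆ (((V.erase a).erase q).erase q')),
          LinearMap.ker (LinearMap.proj (R := K) (φ := fun _ : {S : Finset α // S.card = j} => K) B))) →
        (∃ d : {S : Finset α // S.card = j + 1} → K, d ∈ (⨆ q' ∈ V, ((⨅ (k : ℕ) (_ : k < (j + 1)),
          LinearMap.ker (Matrix.mulVecLin (Matrix.of fun (S : {S : Finset α // S.card = k}) (T : {S : Finset α // S.card = (j + 1)}) =>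
        if S.1 ⊆ T.1 then (1 : K) else 0))) ⊓
        (⨅ (B : {S : Finset α // S.card = (j + 1)}) (_ : ¬ B.1 ⊆ (V.erase q')),
          LinearMap.ker (LinearMap.proj (R := K) (φ := fun _ : {S : Finset α // S.card = (j + 1)} => K) B)))) ∧
          ∀ B : {S : Finset α // S.card = j + 1}, ¬ B.1 ⊆ V.erase a
              → (Matrix.mulVecLin (Matrix.of fun (B : {S : Finset α // S.card = j + 1}) (B' : {S : Finset α // S.card = j}) =>
        if B.1 = insert a B'.1 then (1 : K) else 0) u - d) B = 0) := by
      intro q hq q' hq' u hu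
      have hu2 := ((mem_shadowKer K j _ u).mp hu).2
      have haW : a ∉ ((V.erase a).erase q).erase q' := fun h =>
        Finset.notMem_erase a V (Finset.mem_of_mem_erase (Finset.mem_of_mem_erase h))
      have hqW : q ∉ ((V.erase a).erase q).erase q' := fun h =>
        Finset.notMem_erase q (V.erase a) (Finset.mem_of_mem_erase h)
      have hd := delta_mem K a q j _ haW hqW u hu
      have hq'a : q' ≠ a := Finset.ne_of_mem_erase (Finset.mem_of_mem_erase hq')
      have hq'q : q' ≠ q := Finset.ne_of_mem_erase hq'
      have hqV : q ∈ V := Finset.mem_of_mem_erase hq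
      have hq'V : q' ∈ V := Finset.mem_of_mem_erase (Finset.mem_of_mem_erase hq')
      have hsub : insert a (insert q (((V.erase a).erase q).erase q')) ⊆ V.erase q' :=
        Finset.insert_subset_iff.mpr ⟨Finset.mem_erase.mpr ⟨hq'a.symm, haV⟩,
          Finset.insert_subset_iff.mpr ⟨Finset.mem_erase.mpr ⟨hq'q.symm, hqV⟩,
            Finset.erase_subset_erase q' ((Finset.erase_subset q _).trans (Finset.erase_subset a V))⟩⟩
      refine ⟨Matrix.mulVecLin (Matrix.of fun (B : {S : Finset α // S.card = j + 1}) (B' : {S : Finset α // S.card = j}) =>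
        if B.1 = insert a B'.1 then (1 : K) else 0) u - Matrix.mulVecLin (Matrix.of fun (B : {S : Finset α // S.card = j + 1}) (B' : {S : Finset α // S.card = j}) =>
        if B.1 = insert q B'.1 then (1 : K) else 0) u,
        Submodule.mem_iSup_of_mem q' (Submodule.mem_iSup_of_mem hq'V (shadowKer_mono K (j + 1) hsub hd)),
        fun B hB => ?_⟩
      rw [sub_sub_cancel]
      refine supp_ins K q j (((V.erase a).erase q).erase q') u hu2 B (fun h => hB (h.trans ?_))
      exact Finset.insert_subset_iff.mpr ⟨hq, (Finset.erase_subset q' _).trans (Finset.erase_subset q _)⟩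
    -- apply the induction principle twice (two rounds of the decomposition one level down)
    have hPmem : ∀ q : α, q ∈ V.erase a → ∀ w : {S : Finset α // S.card = j} → K, w ∈ ((⨅ (k : ℕ) (_ : k < j),
          LinearMap.ker (Matrix.mulVecLin (Matrix.of fun (S : {S : Finset α // S.card = k}) (T : {S : Finset α // S.card = j}) =>
        if S.1 ⊆ T.1 then (1 : K) else 0))) ⊓
        (⨅ (B : {S : Finset α // S.card = j}) (_ : ¬ B.1 ⊆ ((V.erase a).erase q)),
          LinearMap.ker (LinearMap.proj (R := K) (φ := fun _ : {S : Finset α // S.card = j} => K) B))) →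
        (∃ d : {S : Finset α // S.card = j + 1} → K, d ∈ (⨆ q' ∈ V, ((⨅ (k : ℕ) (_ : k < (j + 1)),
          LinearMap.ker (Matrix.mulVecLin (Matrix.of fun (S : {S : Finset α // S.card = k}) (T : {S : Finset α // S.card = (j + 1)}) =>
        if S.1 ⊆ T.1 then (1 : K) else 0))) ⊓
        (⨅ (B : {S : Finset α // S.card = (j + 1)}) (_ : ¬ B.1 ⊆ (V.erase q')),
          LinearMap.ker (LinearMap.proj (R := K) (φ := fun _ : {S : Finset α // S.card = (j + 1)} => K) B)))) ∧
          ∀ B : {S : Finset α // S.card = j + 1}, ¬ B.1 ⊆ V.erase a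
              → (Matrix.mulVecLin (Matrix.of fun (B : {S : Finset α // S.card = j + 1}) (B' : {S : Finset α // S.card = j}) =>
        if B.1 = insert a B'.1 then (1 : K) else 0) w - d) B = 0) := by
      intro q hq w hw
      have hcard : 2 * j + 1 ≤ ((V.erase a).erase q).card := by
        have := Finset.card_erase_add_one hq
        omega
      exact biSup_induction K ((V.erase a).erase q) (fun q' => ((⨅ (k : ℕ) (_ : k < j),
          LinearMap.ker (Matrix.mulVecLin (Matrix.of fun (S : {S : Finset α // S.card = k}) (T : {S : Finset α // S.card = j}) =>
        if S.1 ⊆ T.1 then (1 : K) else 0))) ⊓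
        (⨅ (B : {S : Finset α // S.card = j}) (_ : ¬ B.1 ⊆ (((V.erase a).erase q).erase q')),
          LinearMap.ker (LinearMap.proj (R := K) (φ := fun _ : {S : Finset α // S.card = j} => K) B))))
        (fun u => ∃ d : {S : Finset α // S.card = j + 1} → K, d ∈ (⨆ q' ∈ V, ((⨅ (k : ℕ) (_ : k < (j + 1)),
          LinearMap.ker (Matrix.mulVecLin (Matrix.of fun (S : {S : Finset α // S.card = k}) (T : {S : Finset α // S.card = (j + 1)}) =>
        if S.1 ⊆ T.1 then (1 : K) else 0))) ⊓
        (⨅ (B : {S : Finset α // S.card = (j + 1)}) (_ : ¬ B.1 ⊆ (V.erase q')),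
          LinearMap.ker (LinearMap.proj (R := K) (φ := fun _ : {S : Finset α // S.card = (j + 1)} => K) B)))) ∧
          ∀ B : {S : Finset α // S.card = j + 1}, ¬ B.1 ⊆ V.erase a
              → (Matrix.mulVecLin (Matrix.of fun (B : {S : Finset α // S.card = j + 1}) (B' : {S : Finset α // S.card = j}) =>
        if B.1 = insert a B'.1 then (1 : K) else 0) u - d) B = 0)
        hP0 hPadd (fun q' hq' u hu => hPpiece q hq q' hq' u hu) w (ih ((V.erase a).erase q) w hcard hw)
    obtain ⟨d, hd, hd'⟩ := biSup_induction K (V.erase a) (fun q => ((⨅ (k : ℕ) (_ : k < j),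
          LinearMap.ker (Matrix.mulVecLin (Matrix.of fun (S : {S : Finset α // S.card = k}) (T : {S : Finset α // S.card = j}) =>
        if S.1 ⊆ T.1 then (1 : K) else 0))) ⊓
        (⨅ (B : {S : Finset α // S.card = j}) (_ : ¬ B.1 ⊆ ((V.erase a).erase q)),
          LinearMap.ker (LinearMap.proj (R := K) (φ := fun _ : {S : Finset α // S.card = j} => K) B))))
      (fun w => ∃ d : {S : Finset α // S.card = j + 1} → K, d ∈ (⨆ q' ∈ V, ((⨅ (k : ℕ) (_ : k < (j + 1)),
          LinearMap.ker (Matrix.mulVecLin (Matrix.of fun (S : {S : Finset α // S.card = k}) (T : {S : Finset α // S.card = (j + 1)}) =>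
        if S.1 ⊆ T.1 then (1 : K) else 0))) ⊓
        (⨅ (B : {S : Finset α // S.card = (j + 1)}) (_ : ¬ B.1 ⊆ (V.erase q')),
          LinearMap.ker (LinearMap.proj (R := K) (φ := fun _ : {S : Finset α // S.card = (j + 1)} => K) B)))) ∧
        ∀ B : {S : Finset α // S.card = j + 1}, ¬ B.1 ⊆ V.erase a
            → (Matrix.mulVecLin (Matrix.of fun (B : {S : Finset α // S.card = j + 1}) (B' : {S : Finset α // S.card = j}) =>
        if B.1 = insert a B'.1 then (1 : K) else 0) w - d) B = 0)
      hP0 hPadd hPmem _ (ih (V.erase a) _ (by omega) hd1)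
    -- conclude: `z − d ∈ S_{j+1}(V ∖ a)`
    have hzd : z - d ∈ ((⨅ (k : ℕ) (_ : k < (j + 1)),
          LinearMap.ker (Matrix.mulVecLin (Matrix.of fun (S : {S : Finset α // S.card = k}) (T : {S : Finset α // S.card = (j + 1)}) =>
        if S.1 ⊆ T.1 then (1 : K) else 0))) ⊓
        (⨅ (B : {S : Finset α // S.card = (j + 1)}) (_ : ¬ B.1 ⊆ (V.erase a)),
          LinearMap.ker (LinearMap.proj (R := K) (φ := fun _ : {S : Finset α // S.card = (j + 1)} => K) B))) := by
      rw [mem_shadowKer]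
      refine ⟨fun k hk => ?_, fun B hB => ?_⟩
      · rw [map_sub, hz'.1 k hk, zero_sub, neg_eq_zero]
        exact LinearMap.mem_ker.mp (iSup_shadowKer_le_ker K (j + 1) V k hk hd)
      · have e1 := supp_sub_ins_del K a j V z hz'.2 B hB
        have e2 := hd' B hB
        rw [Pi.sub_apply] at e1 e2 ⊢
        linear_combination e1 + e2
    rw [← sub_add_cancel z d]
    exact Submodule.add_mem _ (Submodule.mem_iSup_of_mem a (Submodule.mem_iSup_of_mem haV hzd)) hd

end Summit.HodgeConjecture.HodgeConjecture.HodgeLocus.Census.InclusionRankDecomp
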